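import Literature.Geometry.Lorentzian.TameBreathingCurve
import Literature.Geometry.Lorentzian.CauchyDevelopmentPrecomp
import Literature.Geometry.Lorentzian.AFEndUnbreathe
import Summits.FinalStateConjecture.FinalStateConjecture.Statement
import Summits.FinalStateConjecture.FinalStateConjecture.Theorems.PhaseMixingCaptureCaptureSufficesC2SettlingTransport
import HarnessLib

/-!
# Crux `CensorshipAlongKerrEnds` (stmt-FinalStateConjecture-18521), line `Sketch`:
# stub `stub_settledBreathing` — SETTLED BREATHING

Write `Good D` for the per-datum property of the summit statement `FinalStateConjecture`: a maximal
vacuum Cauchy development of `D` exists, and every maximal vacuum Cauchy development of `D` has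
complete `𝓘⁺` and carries a `C²` sub-extremal `2`-Kerr `FinalStateDecomposition` of
`O = exteriorOf`, with `RaysStayInClosure`, `HasExhaustiveCharts`, `IsFutureOriented`.

**Settled breathing.** Through every admissible datum `D₀` with `Good D₀` passes a one-parameter
family `G : ℝ¹ → InitialDataSet (𝓡 3) X`, tame on some asymptotically flat end, immersed at `0`,
with `G 0 = D₀`, all of whose members are admissible AND good.

Witness: the BREATHING CURVE `c ↦ (breathe (σ (c 0)))^* D₀` of `D₀` on a coordinate ball far out on
its sole end, read on a collared restriction of that end — exactly the self-witness of
`Literature.Geometry.Lorentzian.InitialDataSet.exists_tame_selfWitness` (`TameBreathingCurve.lean`).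
Each member is the re-indexing `D₀.comap Φ` of `D₀` along a diffeomorphism `Φ` of `X`, and `Good`
is invariant under such re-indexings: the maximal developments of `Φ^* D₀` are the re-indexed
maximal developments of `D₀` (`VacuumCauchyDevelopment.precomp`, same spacetime, embedding `ι ∘ Φ`),
on which complete `𝓘⁺` and the settling clause transfer
(`Theorems.PhaseMixingCaptureCaptureSufficesC2.summit_breatheFamily`, built on
`VacuumCauchyDevelopment.exists_isMaximal_comap_iff` / `forall_isMaximal_comap_iff` and
`hasCompleteFutureNullInfinity_precomp_iff` of `CauchyDevelopmentPrecomp.lean`).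

References: Christodoulou, CQG 16 (1999) A23, p. A24 (genericity in a fixed space of data);
Choquet-Bruhat–Geroch, CMP 14 (1969), p. 330 (diffeomorphism covariance of developments).
-/

-- the doubled `FinalStateConjecture.FinalStateConjecture` path component trips dupNamespace
set_option linter.dupNamespace false

noncomputable section

open Set Function Filter
open scoped Manifold ContDiff Topology

namespace Summit.FinalStateConjecture.FinalStateConjecture.Theorems.ExactKerrEnds.CensorshipAlongKerrEnds

open Literature.Geometry.Lorentzian
open Summit.FinalStateConjecture.FinalStateConjecture.Theorems.PhaseMixingCaptureCaptureSufficesC2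
  (summit_breatheFamily)

/-- **Stub `stub_settledBreathing` — SETTLED BREATHING.** Through every admissible datum `D₀` all of
whose maximal vacuum Cauchy developments have complete `𝓘⁺` and settle down (and which has one)
passes a family of initial data, tame on a collared restriction of the sole end of `D₀`, immersed at
`0`, through `D₀` at `0`, admissible, ALL of whose members have the same property: the breathing
curve of `D₀` (`AFEnd.breatheFamily`), the property being transported along the breathing
diffeomorphisms (`summit_breatheFamily`). [cite: Christodoulou1999, p. A24] -/
theorem stub_settledBreathing :
    ∀ (X : Type) [TopologicalSpace X] [ChartedSpace Literature.Geometry.Lorentzian.E3 X] [IsManifold (𝓡 3) ((⊤ : ℕ∞) : WithTop ℕ∞) X] [T2Space X] [SecondCountableTopology X] [ConnectedSpace X], ∀ D₀ ∈ Literature.Geometry.Lorentzian.admissibleVacuumData X, ((∃ 𝒟 : Literature.Geometry.Lorentzian.VacuumCauchyDevelopment D₀, 𝒟.IsMaximal) ∧ ∀ 𝒟 : Literature.Geometry.Lorentzian.VacuumCauchyDevelopment D₀, 𝒟.IsMaximal → Summit.FinalStateConjecture.HasCompleteNullInfinity 𝒟.toCauchyDevelopment ∧ ∃ (O : Set 𝒟.carrier)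 (d : Literature.Geometry.Lorentzian.FinalStateDecomposition 𝒟.toSpacetime O 2), (∀ i, Literature.Geometry.Lorentzian.Kerr.IsSubextremal (d.mass i) (d.spin i)) ∧ O = Summit.FinalStateConjecture.exteriorOf 𝒟.toCauchyDevelopment d.charted ∧ Summit.FinalStateConjecture.RaysStayInClosure 𝒟.toCauchyDevelopment O ∧ Summit.FinalStateConjecture.HasExhaustiveCharts d ∧ Summit.FinalStateConjecture.IsFutureOriented d) → ∃ (e : Literature.Geometry.Lorentzian.AFEnd X) (G : EuclideanSpace ℝ (Fin 1) → Literature.Geometry.Lorentzian.InitialDataSet (𝓡 3) X), Literature.Geometry.Lorentzian.InitialDataSet.IsTameDataFamily e 1 G ∧ Literature.Geometry.Lorentzian.InitialDataSet.IsImmersedAtZero 1 G ∧ G 0 = D₀ ∧ (∀ c, G c ∈ Literature.Geometry.Lorentzian.admissibleVacuumData X) ∧ ∀ c, ((∃ 𝒟 : Literature.Geometry.Lorentzian.VacuumCauchyDevelopment (G c), 𝒟.IsMaximal) ∧ ∀ 𝒟 : Literature.Geometry.Lorentzian.VacuumCauchyDevelopment (G c), 𝒟.IsMaximal → Summit.FinalStateConjecture.HasCompleteNullInfinity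 𝒟.toCauchyDevelopment ∧ ∃ (O : Set 𝒟.carrier) (d : Literature.Geometry.Lorentzian.FinalStateDecomposition 𝒟.toSpacetime O 2), (∀ i, Literature.Geometry.Lorentzian.Kerr.IsSubextremal (d.mass i) (d.spin i)) ∧ O = Summit.FinalStateConjecture.exteriorOf 𝒟.toCauchyDevelopment d.charted ∧ Summit.FinalStateConjecture.RaysStayInClosure 𝒟.toCauchyDevelopment O ∧ Summit.FinalStateConjecture.HasExhaustiveCharts d ∧ Summit.FinalStateConjecture.IsFutureOriented d) := by
  intro X _ _ _ _ _ _ D₀ hD₀ hS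
  obtain ⟨-, e, M, hsole, hdecay⟩ := id hD₀
  -- a breathing ball far out on the sole end of `D₀` (as in `InitialDataSet.exists_tame_selfWitness`)
  set z₀ : E3 := (e.R + 3) • EuclideanSpace.single (0 : Fin 3) (1 : ℝ) with hz₀
  have hz₀n : ‖z₀‖ = e.R + 3 := by
    rw [hz₀, norm_smul, PiLp.norm_single, norm_one, mul_one,
      Real.norm_of_nonneg (by linarith [e.R_pos])]
  have B : e.BreathingData z₀ 1 := ⟨one_pos, by rw [hz₀n]; linarith⟩
  have hR₁ : e.R < e.R + 1 := by linarith
  exact ⟨e.restrict hR₁.le, fun c ↦ AFEnd.breatheFamily B D₀ (c 0),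
    AFEnd.isTameDataFamily_restrict_breatheCurve B D₀ hsole hdecay hR₁,
    AFEnd.isImmersedAtZero_breatheCurve B D₀, AFEnd.breatheCurve_zero B D₀,
    fun c ↦ AFEnd.breatheCurve_mem_admissibleVacuumData B D₀ hD₀ c,
    fun c ↦ summit_breatheFamily B D₀ (c 0) hS⟩

end Summit.FinalStateConjecture.FinalStateConjecture.Theorems.ExactKerrEnds.CensorshipAlongKerrEnds

end
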